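import Summits.BirchSwinnertonDyer.BirchSwinnertonDyer.Theorems.ByReductionTypeAtTwoMultTransportKlein
import Literature.NumberTheory.EllipticCurves.IsogenyQuotientCurveProofs
import Literature.NumberTheory.EllipticCurves.IsogenyVariableChangeProofs
import Literature.NumberTheory.EllipticCurves.IsogenyCompProofs
import Literature.NumberTheory.EllipticCurves.IsogenyDualProofs
import Literature.NumberTheory.EllipticCurves.GlobalMinimalModelProofs
import HarnessLib

/-!
# T-42 in the kernel, C — «F1 ROAD» brick B5 (f): THE `2`-ISOGENY QUOTIENT `W → W/⟨P₀⟩` ONTO A GLOBALLY MINIMAL MODEL, WITH ITS DUAL —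
# for every elliptic `W/ℚ` and every rational point `P₀` of order `2`: a globally minimal `V`, `φ : W → V` with `φ(P₀) = O`, `ker φ ⊆ {O, P₀}`,
# and `ψ : V → W` with `ψ ∘ φ = [2]` — all KERNEL (AEC III.4.12 quotient, Néron's minimal model over `ℚ`, the dual isogeny)

Cell `bsd-2adic` (run/shared/lean/pub/bsd-2adic/), seat `bsd-2adic-t42` GEN 34 (pen RC-540 SUMMON, brick B5 of road (S-C′), memo
`t42/DESIGN-T42-ADDENDUM-38.md`). HONEST FRAMING: research route; THEOREMS ONLY (no `def`, no named fact, no instance, no `sorry`); nothing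
booked; no door or class file is touched (k6); BSD is not proved by any of this. PARTITION: X5@2 multiplicative GV-transport rows (K4ᵐ B1·O1;
items 19922 / 19923) × p = 2 — reduces-the-named-input-of (XCII's side condition `hB`); bears_on K4 (`--supports stmt-BirchSwinnertonDyer-19923`).

## What

`exists_twoIsogeny_quotient` — the input `(V, φ, ψ)` of XCIX `not_twoTorsionRamifiedAtTwo_of_twoIsogeny_quotient` / `isogenyCert_of_twoIsogeny_quotient`
EXISTS for every elliptic `W/ℚ` and every rational `P₀ = (x, y)` of order `2`: the subgroup `{O, P₀} = ℤ·P₀ ⊆ W(ℚ̄)` is finite of order `2`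
and `Γ_ℚ`-stable (`P₀` rational), so the tree's quotient theorem `exists_isogeny_ker_eq_and_comp_eq_nsmul_holds` (AEC III.4.12 + Rem.
III.4.13.2, PROVED in `IsogenyQuotientCurveProofs`) gives `g : W → W₀` with `ker g = ℤ·P₀`; Néron's global minimal model over `ℚ`
(`hasGlobalMinimalModel_rat_holds`) and the change of variables as an isogeny (`VariableChange.toIsogeny`, degree `1`) give the globally minimal
`V = C • W₀` and `φ = ι_C ∘ g` of degree `2`; the dual `ψ` with `ψ ∘ φ = [deg φ] = [2]` is `Isogeny.exists_dual_of_isElliptic` (AEC III.6.1).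
So after this file the ONLY datum of XCIX/XCVIII's certificate that is not produced from `W` is the uniqueness of the rational `2`-torsion of
the quotient (audit D-NOTE B5-CHAIN §3 (β): it fails exactly when the quotient is a full-`2`-torsion curve).

References: [SilvermanAEC2009] Prop. III.4.12, Rem. III.4.13.2, Thm. III.6.1–6.2, VIII.8 Cor. 8.3; [GreenbergVatsal2000] §2 p. 28.
-/

set_option autoImplicit false
set_option linter.dupNamespace false

noncomputable section

open scoped Classical

namespace Summit.BirchSwinnertonDyer.BirchSwinnertonDyer.Theorems.MultTransportTwistedDescent

open WeierstrassCurve Literature.NumberTheory.EllipticCurves Field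
  Summit.BirchSwinnertonDyer.BirchSwinnertonDyer.Theorems.MultTransportAtTwo

variable (W : WeierstrassCurve ℚ) [W.IsElliptic]

/-- **The `2`-isogeny quotient by a rational point of order `2`, onto a globally minimal model, with its dual.** For an elliptic `W/ℚ` and a
rational affine point `P₀ = (x, y)` with `2y + a₁x + a₃ = 0` there are a globally minimal elliptic `V/ℚ`, `ℚ`-isogenies `φ : W → V`, `ψ : V → W` with
`ψ ∘ φ = [2]` on `W(ℚ̄)`, `φ(P₀) = O` and `ker φ ⊆ {O, P₀}` (in fact `= {O, P₀}`). Quotient by the finite `Γ_ℚ`-stable subgroup `ℤ·P₀`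
(`exists_isogeny_ker_eq_and_comp_eq_nsmul_holds`), global minimal model (`hasGlobalMinimalModel_rat_holds`), change of variables as an isogeny
(`VariableChange.toIsogeny`), dual isogeny (`Isogeny.exists_dual_of_isElliptic`). [cite: SilvermanAEC2009, Prop. III.4.12 with Rem. III.4.13.2, Thm. III.6.1(a), VIII.8 Cor. 8.3] -/
theorem exists_twoIsogeny_quotient {x y : ℚ} (hxy : W.toAffine.Nonsingular x y) (h2 : 2 * y + W.a₁ * x + W.a₃ = 0) :
    ∃ (V : WeierstrassCurve ℚ) (_ : V.IsElliptic) (_ : V.IsGloballyMinimal) (φ : Isogeny W V) (ψ : Isogeny V W),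
      (∀ P : W.geomPoints, ψ (φ P) = ((2 ^ 1 : ℕ) : ℤ) • P) ∧ φ (toGeomPoints W (.some x y hxy)) = 0 ∧
      (∀ P : W.geomPoints, φ P = 0 → P = 0 ∨ P = toGeomPoints W (.some x y hxy)) := by
  haveI : Fact (Nat.Prime 2) := ⟨Nat.prime_two⟩
  haveI : PerfectField ℚ := PerfectField.ofCharZero
  set P₀ : W.geomPoints := toGeomPoints W (.some x y hxy) with hP₀def
  -- `P₀` has order `2`
  have hP₀2 : P₀ + P₀ = 0 := by
    obtain ⟨y₁, h₁, P₁, hP₁, -, -, h2₁⟩ := exists_geomTorsion_two_of_hasRationalTwoTorsionX W ⟨y,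
      (WeierstrassCurve.Affine.equation_iff_nonsingular).mpr hxy, h2⟩
    obtain rfl : y₁ = y := by linarith
    have hP₁g : (P₁ : W.geomPoints) = P₀ := by
      rw [hP₁, hP₀def]
      exact (some_eq_some_geomPoints W (X₁ := algebraMap ℚ (AlgebraicClosure ℚ) x) (Y₁ := algebraMap ℚ (AlgebraicClosure ℚ) y₁)
        (h₁ := (WeierstrassCurve.Affine.baseChange_nonsingular (W := W.toAffine) (Algebra.ofId ℚ (AlgebraicClosure ℚ)).injective ..).mpr hxy)
        (eq_ratCast _ x) (eq_ratCast _ y₁)).symm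
    rw [← hP₁g, ← AddSubgroup.coe_add, add_self_geomTorsion_two W P₁, ZeroMemClass.coe_zero]
  have hP₀ne : P₀ ≠ 0 := by
    rw [hP₀def]
    intro h
    exact WeierstrassCurve.Affine.Point.some_ne_zero hxy (toGeomPoints_injective W (by rw [h, map_zero]))
  have hord : addOrderOf P₀ = 2 := addOrderOf_eq_prime (by rw [two_nsmul]; exact hP₀2) hP₀ne
  -- the subgroup `S = ℤ·P₀ = {O, P₀}`
  set S : AddSubgroup W.geomPoints := AddSubgroup.zmultiples P₀ with hS
  have hmemS : ∀ Q : W.geomPoints, Q ∈ S → Q = 0 ∨ Q = P₀ := by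
    intro Q hQ
    obtain ⟨k, rfl⟩ := AddSubgroup.mem_zmultiples_iff.mp hQ
    rcases Int.even_or_odd k with ⟨m, rfl⟩ | ⟨m, rfl⟩
    · left
      rw [← two_mul, mul_comm, mul_zsmul, two_zsmul, hP₀2, zsmul_zero]
    · right
      rw [add_zsmul, one_zsmul, mul_comm, mul_zsmul, two_zsmul, hP₀2, zsmul_zero, zero_add]
  have hScard : Nat.card S = 2 := by rw [hS, Nat.card_zmultiples, hord]
  have hSfin : (S : Set W.geomPoints).Finite := by
    have : Finite S := Nat.finite_of_card_ne_zero (by rw [hScard]; norm_num)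
    exact Set.toFinite _
  have hSstab : ∀ (σ : absoluteGaloisGroup ℚ) (P : W.geomPoints), P ∈ S → σ • P ∈ S := by
    intro σ P hP
    obtain ⟨k, rfl⟩ := AddSubgroup.mem_zmultiples_iff.mp hP
    have h : σ • (k • P₀) = k • P₀ := by
      rw [show σ • (k • P₀) = k • (σ • P₀) from map_zsmul (DistribSMul.toAddMonoidHom W.geomPoints σ) k P₀, hP₀def,
        smul_toGeomPoints]
    rw [h]
    exact AddSubgroup.mem_zmultiples_iff.mpr ⟨k, rfl⟩
  -- the quotient `g : W → W₀` with `ker g = S`, and a globally minimal model `V = C • W₀`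
  obtain ⟨W₀, hW₀, g, -, hker, -, -⟩ := W.exists_isogeny_ker_eq_and_comp_eq_nsmul_holds S hSfin hSstab
  obtain ⟨C, hC⟩ := hasGlobalMinimalModel_rat_holds W₀
  let φ : Isogeny W (C • W₀) := (VariableChange.toIsogeny W₀ C).comp g
  have hφker : φ.toAddMonoidHom.ker = S := by
    change ((VariableChange.toIsogeny W₀ C).comp g).toAddMonoidHom.ker = S
    rw [Isogeny.ker_comp, VariableChange.ker_toIsogeny, AddMonoidHom.comap_bot, hker]
  have hdeg : φ.degree = 2 := by
    unfold Isogeny.degree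
    rw [hφker, hScard]
  obtain ⟨ψ, hψ⟩ := φ.exists_dual_of_isElliptic
  refine ⟨C • W₀, inferInstance, hC, φ, ψ, fun P ↦ by rw [hψ P, hdeg, pow_one], ?_, fun P hP ↦ hmemS P ?_⟩
  · have h : P₀ ∈ φ.toAddMonoidHom.ker := by
      rw [hφker]
      exact AddSubgroup.mem_zmultiples P₀
    exact (AddMonoidHom.mem_ker).mp h
  · rw [← hφker, AddMonoidHom.mem_ker]
    exact hP

end Summit.BirchSwinnertonDyer.BirchSwinnertonDyer.Theorems.MultTransportTwistedDescent

end
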